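import Mathlib
import Literature.AlgebraicGeometry.HodgeTheory.AbelianVarietyEndomorphismsHOne
import Literature.AlgebraicGeometry.HodgeTheory.HodgeTypeConjugation
import Literature.AlgebraicGeometry.HodgeTheory.HodgeTypeExteriorProduct
import Literature.AlgebraicGeometry.Motives.AbelianVarietyCohomologyExteriorH1
import Literature.AlgebraicGeometry.Motives.AbelianVarietyProjectiveChart
import HarnessLib

/-!
# André 1992 in product form, carrier lemmas II: Lagrange coefficient extraction, the elementary-symmetric
# criterion for constant multisets, the rational symmetric-function operators `R_k`, and the wedge basis of `Hᵈ`

Part of the Literature-side proof of André's theorem in product form (record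
`HodgeTheory.Andre1992_hodgeClasses_cmTypedProduct_mem_span_pullback_weilLines`; André 1992, Théorème = Deligne–Milne
LNM 900 endnote M.12 = Charles–Schnell 2014 Thm. 11.5.21 = Milne 2020 Thm. 1), discharged in
`ComplexMultiplication/AndreProductFormHolds.lean`. Linear algebra only; nothing about algebraic cycles is asserted.

* Part 1 (interpolation). A rational matrix `V` with `coeff_k(h) = Σ_t V k t · h(t)` for complex polynomials of degree
  `≤ d` (Lagrange interpolation at the nodes `0, …, d`; `exists_coeff_interpolation`).
* Part 2 (constant multisets). For a multiset `M` of `d` complex numbers, `dᵏ e_k(M) = C(d,k) e₁(M)ᵏ` for all `k ≤ d` iff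
  `M` is constant (`esymm_criterion`; expand `∏ (X + r) = (X + e₁/d)ᵈ`).
* Part 3 (the operators `R_k`). For an endomorphism `Y` of a complex abelian variety `B` and a degree `d`: linear
  operators `R_k = dᵏ E_k − C(d,k) E₁ᵏ` on `Hᵈ(B(ℂ); ℂ)`, rational combinations and composites of the pull-backs
  `(x•𝟙 + Y)^*` (`x = 0, …, d`), hence preserving rational classes and Hodge types, acting on a joint eigenvector with
  conjugate multiset `M` by `dᵏ e_k(M) − C(d,k) e₁(M)ᵏ` (`exists_andreSymmetricOperators`) — Deligne's use of the
  `E`-action to cut out the single-label part, LNM 900 §4 (4.4).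
* Part 4 (wedge basis). From a basis `𝔅` of `H¹(B(ℂ); ℂ)` the wedge basis `Bw` of `Hᵈ(B(ℂ); ℂ) = ⋀ᵈ H¹` indexed by
  `d`-subsets, on which an endomorphism diagonal on `𝔅` acts by the product of its eigenvalues
  (`exists_andreWedgeBasis`; Lange–Birkenhake Lemma 1.1.17, Mumford §1).

## References
* [Andre1992HodgeCM] Y. André, *Une remarque à propos des cycles de Hodge de type CM*, Progr. Math. 102 (1992) 1–7, Théorème.
* [Deligne1982HodgeCycles] P. Deligne (notes by J. S. Milne), LNM 900 (1982), §4 (4.3)–(4.4), endnote M.12.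
* [CharlesSchnell2014Notes] F. Charles, C. Schnell, *Notes on absolute Hodge classes* (2014), Thm. 11.5.21 and proof (pp. 510–511).
* [LangeBirkenhake1992] H. Lange, Ch. Birkenhake, *Complex Abelian Varieties* (1992), Lemma 1.1.17, Exercise 1.1.6 (7).
* [MumfordAV1970] D. Mumford, *Abelian Varieties* (1970), §1 (3)–(4).
-/

noncomputable section

namespace Literature.AlgebraicGeometry.ComplexMultiplication.AndreProductForm

/-! ## Part 1: rational coefficient extraction by Lagrange interpolation -/

section Part1

open Polynomial Finset

/-- Base change of a Lagrange basis divisor `C (x - y)⁻¹ * (X - C y)` along a ring homomorphism of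
fields. [cite: Deligne1982HodgeCycles, §4 (4.4), auxiliary step (Lagrange interpolation)] -/
theorem map_basisDivisor {F K : Type*} [Field F] [Field K] (φ : F →+* K) (x y : F) :
    (Lagrange.basisDivisor x y).map φ = Lagrange.basisDivisor (φ x) (φ y) := by
  simp [Lagrange.basisDivisor, Polynomial.map_mul, Polynomial.map_sub, map_inv₀]

/-- Base change of the Lagrange basis polynomials along a ring homomorphism of fields: the Lagrange
basis at the nodes `φ ∘ v` is the image of the Lagrange basis at the nodes `v`. [cite: Deligne1982HodgeCycles, §4 (4.4), auxiliary step (Lagrange interpolation)] -/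
theorem map_lagrangeBasis {F K : Type*} [Field F] [Field K] (φ : F →+* K) {ι : Type*}
    [DecidableEq ι] (s : Finset ι) (v : ι → F) (i : ι) :
    (Lagrange.basis s v i).map φ = Lagrange.basis s (fun j => φ (v j)) i := by
  simp [Lagrange.basis, Polynomial.map_prod, map_basisDivisor]

/-- The coefficients of a polynomial of degree `< #s` over a field are the node values weighted by the
coefficients of the Lagrange basis polynomials: `coeff_k(f) = Σ_{i ∈ s} f(v i) · coeff_k(L_i)`.
 [cite: Deligne1982HodgeCycles, §4 (4.4), auxiliary step (Lagrange interpolation)] -/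
theorem coeff_eq_sum_eval_mul_coeff_lagrangeBasis {F : Type*} [Field F] {ι : Type*} [DecidableEq ι]
    {s : Finset ι} {v : ι → F} (hvs : Set.InjOn v s) {f : F[X]} (hf : f.degree < #s) (k : ℕ) :
    f.coeff k = ∑ i ∈ s, f.eval (v i) * (Lagrange.basis s v i).coeff k := by
  conv_lhs => rw [Lagrange.eq_interpolate hvs hf]
  rw [Lagrange.interpolate_apply, Polynomial.finsetSum_coeff]
  simp [Polynomial.coeff_C_mul]

/-- **Rational coefficient extraction.** For every `d` there is a
rational matrix `V : Fin (d+1) → Fin (d+1) → ℚ` with `Σ_t V k t · h(t) = coeff_k(h)` for every complex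
polynomial `h` of degree `≤ d` and every `k ≤ d`: take `V k t := coeff_k` of the `t`-th Lagrange basis
polynomial over `ℚ` for the nodes `0, 1, …, d`; then `h = Σ_t h(t) L_t` (Lagrange interpolation,
`Lagrange.eq_interpolate`) and the complex Lagrange basis at the nodes `(t : ℂ)` is the base change of
the rational one. [cite: Deligne1982HodgeCycles, §4 (4.4), auxiliary step (Lagrange interpolation)] -/
theorem exists_coeff_interpolation : ∀ d : ℕ, ∃ V : Fin (d + 1) → Fin (d + 1) → ℚ, ∀ (h : Polynomial ℂ), h.natDegree ≤ d → ∀ k : Fin (d + 1), ∑ t : Fin (d + 1), (V k t : ℂ) * h.eval ((t : ℕ) : ℂ) = h.coeff (k : ℕ) := by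
  intro d
  refine ⟨fun k t => (Lagrange.basis Finset.univ (fun j : Fin (d + 1) => ((j : ℕ) : ℚ)) t).coeff
    (k : ℕ), fun h hh k => ?_⟩
  dsimp only
  -- the complex nodes `0, 1, …, d` are pairwise distinct
  have hvs : Set.InjOn (fun t : Fin (d + 1) => ((t : ℕ) : ℂ)) (Finset.univ : Finset (Fin (d + 1))) := by
    intro a _ b _ hab
    have hab' : ((a : ℕ) : ℂ) = ((b : ℕ) : ℂ) := hab
    exact Fin.ext (by exact_mod_cast hab')
  have hdeg : h.degree < #(Finset.univ : Finset (Fin (d + 1))) := by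
    rw [Finset.card_univ, Fintype.card_fin]
    exact lt_of_le_of_lt (Polynomial.degree_le_of_natDegree_le hh)
      (by exact_mod_cast Nat.lt_succ_self d)
  rw [coeff_eq_sum_eval_mul_coeff_lagrangeBasis hvs hdeg (k : ℕ)]
  refine Finset.sum_congr rfl fun t _ => ?_
  -- the complex Lagrange basis at the nodes `(t : ℂ)` is the base change of the rational one
  have hb : (Lagrange.basis Finset.univ (fun j : Fin (d + 1) => ((j : ℕ) : ℚ)) t).map
      (algebraMap ℚ ℂ) = Lagrange.basis Finset.univ (fun j : Fin (d + 1) => ((j : ℕ) : ℂ)) t := by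
    rw [map_lagrangeBasis]
    simp only [map_natCast]
  rw [mul_comm, ← hb, Polynomial.coeff_map, eq_ratCast]

end Part1

/-! ## Part 2: the elementary-symmetric criterion for constant multisets -/

section Part2

open Polynomial

/-- **Elementary symmetric functions of a constant multiset**: `e_k(r, …, r) = C(d,k) · rᵏ`
(`d` copies of `r`). Every `k`-sub-multiset of `replicate d r` is `replicate k r`
(`Multiset.eq_replicate`), of product `rᵏ`, and there are `C(d,k)` of them
(`Multiset.card_powersetCard`). [cite: Deligne1982HodgeCycles, §4 (4.4), auxiliary step] -/
theorem esymm_replicate {R : Type*} [CommSemiring R] (d k : ℕ) (r : R) :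
    (Multiset.replicate d r).esymm k = (d.choose k : R) * r ^ k := by
  rw [Multiset.esymm]
  have hmap : ((Multiset.replicate d r).powersetCard k).map Multiset.prod =
      ((Multiset.replicate d r).powersetCard k).map fun _ => r ^ k := by
    refine Multiset.map_congr rfl fun x hx => ?_
    rw [Multiset.mem_powersetCard] at hx
    rw [Multiset.eq_replicate.2 ⟨hx.2, fun b hb => Multiset.eq_of_mem_replicate
      (Multiset.mem_of_le hx.1 hb)⟩, Multiset.prod_replicate]
  rw [hmap, Multiset.map_const', Multiset.sum_replicate, Multiset.card_powersetCard,
    Multiset.card_replicate, nsmul_eq_mul]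

/-- **Roots of `∏_{r ∈ s} (X + r)`**: the multiset of roots of `(s.map fun r => X + C r).prod` is
`s.map Neg.neg` (`X + C r = X - C (-r)` and `Polynomial.roots_multiset_prod_X_sub_C`). [cite: Deligne1982HodgeCycles, §4 (4.4), auxiliary step] -/
theorem roots_multiset_prod_X_add_C {R : Type*} [CommRing R] [IsDomain R] (s : Multiset R) :
    (s.map fun r => X + C r).prod.roots = s.map Neg.neg := by
  have hs : (s.map fun r => X + C r) = (s.map Neg.neg).map fun a => X - C a := by
    rw [Multiset.map_map]
    refine Multiset.map_congr rfl fun r _ => ?_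
    simp [sub_eq_add_neg]
  rw [hs, roots_multiset_prod_X_sub_C]

/-- **Elementary-symmetric criterion for a constant multiset**. For a multiset `M` of `d > 0` complex numbers,
`dᵏ · e_k(M) = C(d,k) · e₁(M)ᵏ` for all `k ≤ d` iff `M = replicate d r` for some `r`.
`⇐`: `e_k(replicate d r) = C(d,k) rᵏ` (`esymm_replicate`), `e₁ = d r`. `⇒`: with `c := e₁(M)/d`
the hypothesis gives `e_k(M) = C(d,k) cᵏ = e_k(replicate d c)` (`k ≤ d`), so by Vieta
(`Multiset.prod_X_add_C_eq_sum_esymm`) `∏_{r ∈ M} (X + r) = (X + c)ᵈ = ∏_{r ∈ replicate d c} (X + r)`,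
and comparing roots (`roots_multiset_prod_X_add_C`, `Multiset.map_injective neg_injective`)
`M = replicate d c`. [cite: Deligne1982HodgeCycles, §4 (4.4), auxiliary step] -/
theorem esymm_power_criterion : ∀ (d : ℕ) (M : Multiset ℂ), M.card = d → 0 < d → ((∀ k : ℕ, k ≤ d → (d : ℂ) ^ k * M.esymm k = (d.choose k : ℂ) * M.esymm 1 ^ k) ↔ ∃ r : ℂ, M = Multiset.replicate d r) := by
  intro d M hM hd
  constructor
  · intro h
    have hd0 : (d : ℂ) ≠ 0 := Nat.cast_ne_zero.2 hd.ne'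
    set c : ℂ := M.esymm 1 / d with hc
    have h1 : M.esymm 1 = d * c := by rw [hc, mul_div_cancel₀ _ hd0]
    -- the hypothesis at `k` reads `e_k(M) = C(d,k) cᵏ`
    have hesymm : ∀ k, k ≤ d → M.esymm k = (d.choose k : ℂ) * c ^ k := by
      intro k hk
      have hk' := h k hk
      rw [h1, mul_pow, ← mul_assoc, mul_comm (d.choose k : ℂ), mul_assoc] at hk'
      exact mul_left_cancel₀ (pow_ne_zero k hd0) hk'
    -- Vieta: `∏_{r ∈ M} (X + r) = ∏_{r ∈ replicate d c} (X + r)`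
    have hprod : (M.map fun r => X + C r).prod =
        ((Multiset.replicate d c).map fun r => X + C r).prod := by
      rw [Multiset.prod_X_add_C_eq_sum_esymm, Multiset.prod_X_add_C_eq_sum_esymm, hM,
        Multiset.card_replicate]
      refine Finset.sum_congr rfl fun j hj => ?_
      rw [Finset.mem_range] at hj
      rw [hesymm j (Nat.lt_succ_iff.1 hj), esymm_replicate]
    -- compare the roots
    have hroots := congrArg Polynomial.roots hprod
    rw [roots_multiset_prod_X_add_C, roots_multiset_prod_X_add_C] at hroots
    exact ⟨c, Multiset.map_injective neg_injective hroots⟩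
  · rintro ⟨r, rfl⟩ k _
    rw [esymm_replicate, esymm_replicate, Nat.choose_one_right, pow_one]
    ring

end Part2

/-! ## Part 3: the rational symmetric-function operators `R_k` -/

section Part3

open _root_.CategoryTheory Polynomial
open Literature.AlgebraicGeometry Literature.AlgebraicGeometry.Motives Literature.AlgebraicGeometry.HodgeTheory

/-- **The rational symmetric-function operators.** Given an endomorphism `Y` of `B`, a degree `d` and a rational
matrix `V` extracting coefficients of complex polynomials of degree `≤ d` from their values at `0, …, d`, there are
linear operators `R_k` on `Hᵈ(B(ℂ); ℂ)` preserving rational classes and Hodge types such that, whenever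
`(x•𝟙 + Y)^* t = ∏_{r∈M}(x + r) · t` for all `x : ℕ` (`M` a multiset of `d` complex numbers),
`R_k t = (dᵏ e_k(M) − C(d,k) e₁(M)ᵏ) · t` for every `k ≤ d`. [cite: Andre1992HodgeCM, Théorème]
[cite: Deligne1982HodgeCycles, §4 (4.4)] -/
theorem exists_andreSymmetricOperators : ∀ (d : ℕ) (B : Literature.AlgebraicGeometry.Motives.AbelianVariety ℂ) (Y : B ⟶ B) (V : Fin (d + 1) → Fin (d + 1) → ℚ), (∀ (h : Polynomial ℂ), h.natDegree ≤ d → ∀ k : Fin (d + 1), ∑ t : Fin (d + 1), (V k t : ℂ) * h.eval ((t : ℕ) : ℂ) = h.coeff (k : ℕ)) → ∃ R : ℕ → (Literature.AlgebraicGeometry.HodgeTheory.complexBetti B.X d →ₗ[ℂ] Literature.AlgebraicGeometry.HodgeTheory.complexBetti B.X d), (∀ k c, Literature.AlgebraicGeometry.HodgeTheory.IsRationalClass c → Literature.AlgebraicGeometry.HodgeTheory.IsRationalClass (R k c)) ∧ (∀ k (p q : ℕ) c, Literature.AlgebraicGeometry.HodgeTheory.IsOfHodgeType B.dim B.X d p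 q c → Literature.AlgebraicGeometry.HodgeTheory.IsOfHodgeType B.dim B.X d p q (R k c)) ∧ (∀ k, k ≤ d → ∀ (t : Literature.AlgebraicGeometry.HodgeTheory.complexBetti B.X d) (M : Multiset ℂ), M.card = d → (∀ x : ℕ, Literature.AlgebraicGeometry.HodgeTheory.complexBetti.map (x • 𝟙 B + Y).hom.hom.hom d t = (M.map fun r => (x : ℂ) + r).prod • t) → R k t = ((d : ℂ) ^ k * M.esymm k - (d.choose k : ℂ) * M.esymm 1 ^ k) • t) := by
  intro d B Y V hV
  classical
  have hB : IsSmoothProjective B.dim B.X := AbelianVariety.isSmoothProjective_holds (A := B)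
  -- the pull-backs `G x = (x•𝟙 + Y)^*` on `Hᵈ`
  let G : ℕ → (complexBetti B.X d →ₗ[ℂ] complexBetti B.X d) := fun x =>
    (complexBetti.map ((x • 𝟙 B + Y) : B ⟶ B).hom.hom.hom d).hom
  have hGapp : ∀ x c, G x c = complexBetti.map ((x • 𝟙 B + Y) : B ⟶ B).hom.hom.hom d c := fun x c => rfl
  -- "good" operators: preserve rational classes and Hodge types
  let Good : (complexBetti B.X d →ₗ[ℂ] complexBetti B.X d) → Prop := fun Q =>
    (∀ c, IsRationalClass c → IsRationalClass (Q c)) ∧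
      (∀ (p q : ℕ) c, IsOfHodgeType B.dim B.X d p q c → IsOfHodgeType B.dim B.X d p q (Q c))
  have hGoodG : ∀ x, Good (G x) := fun x =>
    ⟨fun c hc => by rw [hGapp]; exact hc.pullback _,
      fun p q c hc => by rw [hGapp]; exact hc.map_of_isSmoothProjective hB hB _⟩
  have hGood_zero : Good 0 := by
    refine ⟨fun c _ => ?_, fun p q c _ => ?_⟩
    · rw [LinearMap.zero_apply]; exact IsRationalClass.zero
    · rw [LinearMap.zero_apply]; exact IsOfHodgeType.zero (nonempty_hodgeModel_holds hB).some d p q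
  have hGood_add : ∀ Q Q', Good Q → Good Q' → Good (Q + Q') := fun Q Q' hQ hQ' =>
    ⟨fun c hc => by rw [LinearMap.add_apply]; exact (hQ.1 c hc).add (hQ'.1 c hc),
      fun p q c hc => by rw [LinearMap.add_apply]; exact IsOfHodgeType.add hB (hQ.2 p q c hc) (hQ'.2 p q c hc)⟩
  have hGood_smul : ∀ (a : ℚ) Q, Good Q → Good ((a : ℂ) • Q) := fun a Q hQ =>
    ⟨fun c hc => by rw [LinearMap.smul_apply]; exact (hQ.1 c hc).smul a,
      fun p q c hc => by rw [LinearMap.smul_apply]; exact IsOfHodgeType.smul (hQ.2 p q c hc) _⟩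
  have hGood_comp : ∀ Q Q', Good Q → Good Q' → Good (Q ∘ₗ Q') := fun Q Q' hQ hQ' =>
    ⟨fun c hc => by rw [LinearMap.comp_apply]; exact hQ.1 _ (hQ'.1 c hc),
      fun p q c hc => by rw [LinearMap.comp_apply]; exact hQ.2 p q _ (hQ'.2 p q c hc)⟩
  have hGood_sum : ∀ {J : Type} (s : Finset J) (Q : J → (complexBetti B.X d →ₗ[ℂ] complexBetti B.X d)),
      (∀ j ∈ s, Good (Q j)) → Good (∑ j ∈ s, Q j) := by
    intro J s Q hQ
    induction s using Finset.induction_on with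
    | empty => rw [Finset.sum_empty]; exact hGood_zero
    | insert a s ha ih =>
      rw [Finset.sum_insert ha]
      exact hGood_add _ _ (hQ a (Finset.mem_insert_self a s)) (ih fun j hj => hQ j (Finset.mem_insert_of_mem hj))
  have hGood_pow : ∀ Q (k : ℕ), Good Q → Good (Q ^ k) := by
    intro Q k hQ
    induction k with
    | zero =>
      rw [pow_zero]
      exact ⟨fun c hc => hc, fun p q c hc => hc⟩
    | succ k ih => rw [pow_succ]; exact hGood_comp _ _ ih hQ
  -- the elementary-symmetric operators `E k` (eigenvalue `e_k`) for `k ≤ d`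
  let E : ℕ → (complexBetti B.X d →ₗ[ℂ] complexBetti B.X d) := fun k =>
    if hk : k ≤ d then ∑ t : Fin (d + 1), ((V ⟨d - k, by omega⟩ t : ℚ) : ℂ) • G t else 0
  have hGoodE : ∀ k, Good (E k) := by
    intro k
    by_cases hk : k ≤ d
    · simp only [E, dif_pos hk]
      exact hGood_sum _ _ fun t _ => hGood_smul _ _ (hGoodG t)
    · simp only [E, dif_neg hk]
      exact hGood_zero
  -- the operators `R k = dᵏ E_k - C(d,k) E_1^k`
  let R : ℕ → (complexBetti B.X d →ₗ[ℂ] complexBetti B.X d) := fun k =>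
    (((d : ℚ) ^ k : ℚ) : ℂ) • E k + ((-(d.choose k : ℚ) : ℚ) : ℂ) • (E 1) ^ k
  have hGoodR : ∀ k, Good (R k) := fun k =>
    hGood_add _ _ (hGood_smul ((d : ℚ) ^ k) _ (hGoodE k))
      (hGood_smul (-(d.choose k : ℚ)) _ (hGood_pow _ k (hGoodE 1)))
  refine ⟨R, fun k => (hGoodR k).1, fun k => (hGoodR k).2, ?_⟩
  -- eigenvalues on a joint eigenvector with conjugate multiset `M`
  intro k hk t M hM hG
  -- the polynomial `h_M = ∏ (X + r)` and its values / coefficients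
  set h : Polynomial ℂ := (M.map fun r => X + C r).prod with hh
  have hmonic : ∀ f ∈ M.map (fun r => X + C r), Monic f := by
    intro f hf
    obtain ⟨r, _, rfl⟩ := Multiset.mem_map.mp hf
    exact monic_X_add_C r
  have hdeg : h.natDegree ≤ d := by
    rw [hh, natDegree_multiset_prod_of_monic _ hmonic, Multiset.map_map]
    have : (M.map (natDegree ∘ fun r => X + C r)) = M.map (fun _ => 1) := by
      refine Multiset.map_congr rfl fun r _ => ?_
      simp
    rw [this, Multiset.map_const', Multiset.sum_replicate, smul_eq_mul, mul_one, hM]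
  have heval : ∀ x : ℕ, h.eval ((x : ℕ) : ℂ) = (M.map fun r => (x : ℂ) + r).prod := by
    intro x
    rw [hh, eval_multiset_prod, Multiset.map_map]
    refine congrArg _ (Multiset.map_congr rfl fun r _ => ?_)
    simp
  have hcoeff : ∀ j, j ≤ d → h.coeff (d - j) = M.esymm j := by
    intro j hj
    rw [hh, Multiset.prod_X_add_C_coeff M (by rw [hM]; omega), hM]
    congr 1
    omega
  -- `E j t = e_j(M) • t` for `j ≤ d`
  have hE : ∀ j, j ≤ d → E j t = M.esymm j • t := by
    intro j hj
    simp only [E, dif_pos hj, LinearMap.coe_sum, Finset.sum_apply, LinearMap.smul_apply, hGapp, hG,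
      smul_smul]
    rw [← Finset.sum_smul]
    congr 1
    have := hV h hdeg ⟨d - j, by omega⟩
    simp only [heval] at this
    rw [this, hcoeff j hj]
  have hE1pow : ∀ m : ℕ, m ≤ d → ((E 1) ^ m) t = M.esymm 1 ^ m • t := by
    intro m hm
    induction m with
    | zero => rw [pow_zero, pow_zero, one_smul, Module.End.one_apply]
    | succ m ih =>
      rw [pow_succ, Module.End.mul_apply, hE 1 (by omega), map_smul, ih (by omega), smul_smul, pow_succ,
        mul_comm]
  show ((((d : ℚ) ^ k : ℚ) : ℂ) • E k + ((-(d.choose k : ℚ) : ℚ) : ℂ) • (E 1) ^ k) t = _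
  rw [LinearMap.add_apply, LinearMap.smul_apply, LinearMap.smul_apply, hE k hk, hE1pow k hk, smul_smul, smul_smul,
    ← add_smul]
  congr 1
  push_cast
  ring

end Part3

/-! ## Part 4: the wedge basis of `Hᵈ(B(ℂ); ℂ)` -/

section Part4

open _root_.CategoryTheory
open Literature.AlgebraicTopology.SingularHomology
open Literature.AlgebraicGeometry Literature.AlgebraicGeometry.Motives Literature.AlgebraicGeometry.HodgeTheory

/-- **The wedge basis of `Hᵈ(B(ℂ); ℂ)` and the diagonal action of endomorphisms on it.** For a basis `𝔅` of
`H¹(B(ℂ); ℂ)` indexed by `Fin N × Fin n` there is a basis `Bw` of `Hᵈ(B(ℂ); ℂ)` indexed by the `d`-element subsets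
`S ⊆ Fin N × Fin n` such that every endomorphism `f` of `B` which is diagonal on `𝔅` (`f^* 𝔅 i = a i • 𝔅 i`) acts
on `Bw S` by `∏_{i ∈ S} a i`. (`Bw S = 𝔅 i₁ ⌣ ⋯ ⌣ 𝔅 i_d` for the increasing enumeration of `S` in an auxiliary
linear order; `H• = ⋀• H¹`, Hopf.) [cite: LangeBirkenhake1992, Lemma 1.1.17 and Exercise 1.1.6 (7)]
[cite: MumfordAV1970, §1 (3)–(4)] -/
theorem exists_andreWedgeBasis : ∀ {N n : ℕ} (d : ℕ) (B : Literature.AlgebraicGeometry.Motives.AbelianVariety ℂ) (𝔅 : Module.Basis (Fin N × Fin n) ℂ (Literature.AlgebraicGeometry.HodgeTheory.complexBetti B.X 1)), ∃ Bw : Module.Basis (Set.powersetCard (Fin N × Fin n) d) ℂ (Literature.AlgebraicGeometry.HodgeTheory.complexBetti B.X d), ∀ (f : B ⟶ B) (a : Fin N × Fin n → ℂ), (∀ i, Literature.AlgebraicGeometry.HodgeTheory.complexBetti.map f.hom.hom.hom 1 (𝔅 i) = a i • 𝔅 i) → ∀ S, Literature.AlgebraicGeometry.HodgeTheory.complexBetti.map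 f.hom.hom.hom d (Bw S) = (∏ i ∈ (S : Finset (Fin N × Fin n)), a i) • Bw S := by
  intro N n d B 𝔅
  classical
  letI : LinearOrder (Fin N × Fin n) :=
    LinearOrder.lift' (finProdFinEquiv : Fin N × Fin n ≃ Fin (N * n)) finProdFinEquiv.injective
  have hΛ : HasExteriorCohomologyH1 ℂ (ComplexPoints B.X) := AbelianVariety.hasExteriorCohomologyH1_complexPoints B
  let Bw : Module.Basis (Set.powersetCard (Fin N × Fin n) d) ℂ (complexBetti B.X d) :=
    (𝔅.exteriorPower d).map (hΛ.equiv d)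
  refine ⟨Bw, ?_⟩
  intro f a ha S
  have hBw : Bw S = cupPowOne ℂ (ComplexPoints B.X) d (𝔅 ∘ (Set.powersetCard.ofFinEmbEquiv.symm S)) := by
    change hΛ.equiv d ((𝔅.exteriorPower d) S) = _
    rw [exteriorPower.basis_apply, HasExteriorCohomologyH1.equiv_apply, exteriorPower.ιMulti_family,
      wedgeToCup_ιMulti]
  rw [hBw]
  change singularCohomology.map ℂ ℂ (AlgPoints.mapContinuous (L := ℂ) f.hom.hom.hom) d (cupPowOne ℂ _ d _) = _
  rw [map_cupPowOne]
  have e : (fun i => singularCohomology.map ℂ ℂ (AlgPoints.mapContinuous (L := ℂ) f.hom.hom.hom) 1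
      ((𝔅 ∘ (Set.powersetCard.ofFinEmbEquiv.symm S)) i)) =
      fun i => a (Set.powersetCard.ofFinEmbEquiv.symm S i) • (𝔅 ∘ (Set.powersetCard.ofFinEmbEquiv.symm S)) i := by
    funext i
    exact ha _
  rw [e, MultilinearMap.map_smul_univ]
  congr 1
  -- `∏ over the enumeration = ∏ over S`
  have hinj : Function.Injective (Set.powersetCard.ofFinEmbEquiv.symm S) :=
    (Set.powersetCard.ofFinEmbEquiv.symm S).injective
  rw [← Finset.prod_image (f := a) hinj.injOn]
  refine Finset.prod_congr ?_ fun _ _ => rfl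
  ext i
  rw [Finset.mem_image]
  constructor
  · rintro ⟨k, _, rfl⟩
    exact (Set.powersetCard.mem_range_ofFinEmbEquiv_symm_iff_mem S _).1 ⟨k, rfl⟩
  · intro hi
    obtain ⟨k, hk⟩ := (Set.powersetCard.mem_range_ofFinEmbEquiv_symm_iff_mem S i).2 hi
    exact ⟨k, Finset.mem_univ _, hk⟩

end Part4

end Literature.AlgebraicGeometry.ComplexMultiplication.AndreProductForm

end
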